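import Literature.NumberTheory.LFunctions.Zhang2022.KnifeEdgeLenZDegreeClosedForms
import Literature.NumberTheory.LFunctions.Zhang2022.KnifeEdgeLenZDegreeAtomsLemmas

/-!
# Zhang (2022), rung F-S3 (Landau–Siegel programme, §D edge len = E*-len⁺): route `ZDegreeToeplitzBand`, the α-layer RECORD —
# S0′ COMPLETENESS (the kernel-row check is a complete two-way switch) and WIDTH (the record type asserts nothing: guard (H5))

Y. Zhang, *Discrete mean estimates and the Landau–Siegel zero*, arXiv:2211.02515v1 [Zhang2022LandauSiegel] — an
unrefereed manuscript under adjudication. **WHAT THIS IS NOT: not a claim about Theorems 1–2 of arXiv:2211.02515, about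
Landau–Siegel zeros, or about Parity. The programme SEARCHES and TYPES; no claim about Landau–Siegel zeros, Theorems 1–2
of arXiv:2211.02515 or a repaired Margin232 until a kernel theorem says so.** `E₀`-free: every theorem is over a VARIABLE
record `E : KnifeEdge.PsiGradedClosedForms` (p509013/p510035) or exhibits an explicit JUNK inhabitant inside a proof (no `def`,
no instance, no table of the route is defined); nothing here says anything about the derived tables of the K1″a hand.

* Part 1 — **S0′ completeness** (critic ls-knife-crit-1 g5, C1 CONFIRM — SCHEMA 07:30:56Z, cert `RecordWidth` v2
  8c6e7cc1f0c13a56): the named check `E.GStarRowsDark` (all four `g⋆`-row clauses: `X₁psi(g⋆,·)`, `X₂psiDiag(g⋆,·)`, both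
  `Y₁psi` legs) is a COMPLETE two-way switch on the record — ONE failing clause closes α3 and refutes the barrier twin
  (`PsiGradedClosedForms.gradedCloses_of_not_gStarRowsDark`, by the tree's 2×2 minors against `𝔅(g⋆) = 0`:
  `gradedCloses_of_gStar_row₁/_row/_dual/_dual'`), and the barrier twin `GradedPSD` forces ALL FOUR clauses
  (`PsiGradedClosedForms.gStarRowsDark_of_gradedPSD`, strengthening the record's `gStar_rows_of_gradedPSD`, which gives the two
  X-rows).
* Part 2 — **WIDTH at the record level** (guard (H5) of ls-lead's AMENDED SEQUENCE 07:00:07Z, kernel-backed): the record has a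
  junk inhabitant `⟨[], [], [ptPt 1 0 0], …⟩` whose degree-2 `g⋆`-row is LIVE (`g⋆(0) = 2`, value `4`) — so it satisfies
  `GradedCloses ∧ ¬GradedPSD` WHILE passing the symmetry check `SymmAsFormulas` — and a junk inhabitant `⟨[], [], [], …⟩` (all
  tables `0`) which is `GradedPSD` and passes BOTH named checks. Hence `∃ E, GradedCloses …` is junk-TRUE (even with the
  symmetry check), `∀ E, GradedPSD …` and `∀ E, GradedCloses …` are FALSE, and the checks do not imply closing: the α items
  (stmt-Parity-20031–33) are meaningful ONLY over the CLOSED TERM `E₀`, never over a bound / ∃-quantified `E`. The same two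
  witnesses inhabit the SYMMETRIC presentation `SymmetricPsiGradedClosedForms` (p510035), which is therefore equally wide.

Typer: ls-knife-typer-3 g8 (WAKE ls-lead g3 08:16:01Z (3); crit-1 g5 08:19:44Z (ii); theory g3 08:19:15Z (A)/(C): E₀-free);
cert author ls-knife-crit-1 g5 (desk namespace `KnifeEdgeProbe`, defs `wideE/darkE/wideS/darkS` inlined here as proof terms).

## References
* Y. Zhang, arXiv:2211.02515v1 (2022), §2 (2.16)–(2.17); §7 Prop. 7.1; §8 (8.5).
  [cite: Zhang2022LandauSiegel, §2 (2.16)–(2.17), §7 Prop 7.1, §8 (8.5)]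
-/

noncomputable section

open Complex ComplexConjugate

namespace Literature.NumberTheory.LFunctions.Zhang2022.KnifeEdge

open Repair Skeleton

/-! ### Part 1 — S0′ completeness over the record -/

namespace PsiGradedClosedForms

/-- **S0′ is a complete switch:** if the kernel-row check `GStarRowsDark` fails in ANY of its four clauses, then α3 closes
(`GradedCloses`) and the barrier twin fails — each live clause is a 2×2 minor against `𝔅(g⋆) = 0` (tree
`gradedCloses_of_gStar_row₁/_row/_dual/_dual'`). [cite: Zhang2022LandauSiegel, §2 (2.16), §7 Prop 7.1] -/
theorem gradedCloses_of_not_gStarRowsDark (E : PsiGradedClosedForms) (h : ¬ E.GStarRowsDark) :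
    GradedCloses E.X₁psi E.Y₁psi E.X₂psiDiag ∧ ¬ GradedPSD E.X₁psi E.Y₁psi E.X₂psiDiag := by
  have hC : GradedCloses E.X₁psi E.Y₁psi E.X₂psiDiag := by
    by_contra hno
    apply h
    intro g g' hg
    refine ⟨?_, ?_, ?_, ?_⟩ <;> by_contra hne
    · exact hno (gradedCloses_of_gStar_row₁ hg hne)
    · exact hno (gradedCloses_of_gStar_row hg hne)
    · exact hno (gradedCloses_of_gStar_dual hg hne)
    · exact hno (gradedCloses_of_gStar_dual' hg hne)
  exact ⟨hC, fun hP => not_gradedCloses_of_gradedPSD hP hC⟩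

/-- **The barrier twin forces ALL FOUR `g⋆`-row clauses** (strengthens `gStar_rows_of_gradedPSD`, which gives the two X-rows):
`GradedPSD E.X₁psi E.Y₁psi E.X₂psiDiag → E.GStarRowsDark`. [cite: Zhang2022LandauSiegel, §2 (2.16), §7 Prop 7.1] -/
theorem gStarRowsDark_of_gradedPSD (E : PsiGradedClosedForms) (hP : GradedPSD E.X₁psi E.Y₁psi E.X₂psiDiag) :
    E.GStarRowsDark := by
  by_contra h
  exact (gradedCloses_of_not_gStarRowsDark E h).2 hP

/-- Contrapositive reading for the α3 cell: a record that does NOT close has all four `g⋆`-rows dark OR is not PSD either —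
precisely, `¬GradedCloses → GStarRowsDark`. [cite: Zhang2022LandauSiegel, §2 (2.16), §7 Prop 7.1] -/
theorem gStarRowsDark_of_not_gradedCloses (E : PsiGradedClosedForms)
    (h : ¬ GradedCloses E.X₁psi E.Y₁psi E.X₂psiDiag) : E.GStarRowsDark := by
  by_contra hD
  exact h (gradedCloses_of_not_gStarRowsDark E hD).1

end PsiGradedClosedForms

/-! ### Part 2 — WIDTH: the record type (and its symmetric presentation) asserts nothing -/

section Width

/-- `g⋆(0) = 2` (`g⋆ = e^{−iπy} + e^{−2iπy}` on `[0,1]`). [cite: Zhang2022LandauSiegel, §7 Prop 7.1] -/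
theorem gStar_zero : gStar 0 = 2 := by rw [gStar_of_le zero_le_one, gCore_zero]

/-- The conjugated one-atom point form `[ptPt 1 0 0]` is LIVE on the kernel row: value `4` at `(g⋆, g⋆)`.
[cite: Zhang2022LandauSiegel, §7 Prop 7.1] -/
theorem conjLeft_eval_ptPt_gStar :
    conjLeft (ClosedForm.eval [ClosedFormAtom.ptPt 1 0 0]) gStar gStar' gStar gStar' = 4 := by
  simp only [ClosedForm.eval_cons, ClosedForm.eval_nil, conjLeft, Pi.add_apply, Pi.zero_apply,
    ClosedFormAtom.eval_ptPt, pointPair, gStar_zero, add_zero, one_mul]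
  norm_num [map_ofNat]

/-- … and symmetric under the swap of the two pieces (all legs). [cite: Zhang2022LandauSiegel, §8 (8.5)] -/
theorem conjLeft_eval_ptPt_swap (f f' g g' : ℝ → ℂ) :
    conjLeft (ClosedForm.eval [ClosedFormAtom.ptPt 1 0 0]) f f' g g' =
      conjLeft (ClosedForm.eval [ClosedFormAtom.ptPt 1 0 0]) g g' f f' := by
  simp only [ClosedForm.eval_cons, ClosedForm.eval_nil, conjLeft, Pi.add_apply, Pi.zero_apply,
    ClosedFormAtom.eval_ptPt, pointPair, add_zero, one_mul]
  ring

/-- The conjugated EMPTY closed form is the zero functional. [cite: Zhang2022LandauSiegel, §7 Prop 7.1] -/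
theorem conjLeft_eval_nil : conjLeft (ClosedForm.eval []) = 0 := by
  funext f f' g g'
  rfl

/-- The one-atom point form `[ptPt 1 0 0]` has its marked points in `[0,1]`. [cite: Zhang2022LandauSiegel, §7 Prop 7.1 (7.2)] -/
theorem kernelsContinuous_ptPt_one_zero_zero : ClosedForm.KernelsContinuous [ClosedFormAtom.ptPt 1 0 0] :=
  ClosedForm.KernelsContinuous.cons (ClosedFormAtom.kernelsContinuous_ptPt 1 ⟨le_rfl, zero_le_one⟩ ⟨le_rfl, zero_le_one⟩)
    ClosedForm.kernelsContinuous_nil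

/-- **WIDTH, closing horn — `∃ E, GradedCloses …` is junk-TRUE, even jointly with the symmetry check:** the record
`⟨[], [], [ptPt 1 0 0], …⟩` passes `SymmAsFormulas`, closes α3 and refutes the barrier twin (its degree-2 `g⋆`-row is live,
`kernelRow_switch₂`). So no α item may be stated over a bound `E`. [cite: Zhang2022LandauSiegel, §2 (2.16)–(2.17), §8 (8.5)] -/
theorem exists_record_symm_gradedCloses :
    ∃ E : PsiGradedClosedForms, E.SymmAsFormulas ∧ GradedCloses E.X₁psi E.Y₁psi E.X₂psiDiag ∧
      ¬ GradedPSD E.X₁psi E.Y₁psi E.X₂psiDiag := by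
  refine ⟨⟨[], [], [ClosedFormAtom.ptPt 1 0 0], ClosedForm.kernelsContinuous_nil,
    ClosedForm.kernelsContinuous_nil, kernelsContinuous_ptPt_one_zero_zero⟩, ⟨fun f f' g g' => ?_, fun f f' g g' => ?_⟩, ?_⟩
  · show conjLeft (ClosedForm.eval []) f f' g g' = conjLeft (ClosedForm.eval []) g g' f f'
    simp [conjLeft]
  · exact conjLeft_eval_ptPt_swap f f' g g'
  · exact PsiGradedClosedForms.kernelRow_switch₂ inClassPiece_gStar (by
      show conjLeft (ClosedForm.eval [ClosedFormAtom.ptPt 1 0 0]) gStar gStar' gStar gStar' ≠ 0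
      rw [conjLeft_eval_ptPt_gStar]; norm_num)

/-- **WIDTH, barrier horn — `∃ E, GradedPSD …` is junk-TRUE, jointly with BOTH named checks:** the record `⟨[], [], [], …⟩`
(all tables `0`) is PSD (`gradedPSD_allDark`), symmetric, and has dark `g⋆`-rows. [cite: Zhang2022LandauSiegel, §2 (2.16)–(2.17)] -/
theorem exists_record_checks_gradedPSD :
    ∃ E : PsiGradedClosedForms, E.SymmAsFormulas ∧ E.GStarRowsDark ∧ GradedPSD E.X₁psi E.Y₁psi E.X₂psiDiag := by
  refine ⟨⟨[], [], [], ClosedForm.kernelsContinuous_nil, ClosedForm.kernelsContinuous_nil,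
    ClosedForm.kernelsContinuous_nil⟩, ?_, ?_, ?_⟩
  · refine ⟨fun f f' g g' => ?_, fun f f' g g' => ?_⟩ <;>
    · show conjLeft (ClosedForm.eval []) f f' g g' = conjLeft (ClosedForm.eval []) g g' f f'
      simp [conjLeft]
  · intro g g' _
    refine ⟨?_, ?_, ?_, ?_⟩
    · show conjLeft (ClosedForm.eval []) gStar gStar' g g' = 0; simp [conjLeft]
    · show conjLeft (ClosedForm.eval []) gStar gStar' g g' = 0; simp [conjLeft]
    · show ClosedForm.eval [] gStar gStar' g g' = 0; simp
    · show ClosedForm.eval [] g g' gStar gStar' = 0; simp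
  · show GradedPSD (conjLeft (ClosedForm.eval [])) (ClosedForm.eval []) (conjLeft (ClosedForm.eval []))
    rw [conjLeft_eval_nil, ClosedForm.eval_nil]
    exact gradedPSD_allDark

/-- `∀ E, GradedPSD …` is FALSE over the record. [cite: Zhang2022LandauSiegel, §2 (2.16)–(2.17)] -/
theorem not_forall_record_gradedPSD : ¬ ∀ E : PsiGradedClosedForms, GradedPSD E.X₁psi E.Y₁psi E.X₂psiDiag := by
  obtain ⟨E, _, _, hE⟩ := exists_record_symm_gradedCloses
  exact fun h => hE (h E)

/-- `∀ E, GradedCloses …` is FALSE over the record. [cite: Zhang2022LandauSiegel, §2 (2.16)–(2.17)] -/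
theorem not_forall_record_gradedCloses : ¬ ∀ E : PsiGradedClosedForms, GradedCloses E.X₁psi E.Y₁psi E.X₂psiDiag := by
  obtain ⟨E, _, _, hE⟩ := exists_record_checks_gradedPSD
  exact fun h => not_gradedCloses_of_gradedPSD hE (h E)

/-- The named checks do NOT imply closing: `∀ E, SymmAsFormulas → GStarRowsDark → GradedCloses …` is FALSE (and already
`∀ E, SymmAsFormulas → GradedCloses …` is). [cite: Zhang2022LandauSiegel, §2 (2.16)–(2.17), §8 (8.5)] -/
theorem not_forall_checks_imp_gradedCloses :
    ¬ ∀ E : PsiGradedClosedForms, E.SymmAsFormulas → GradedCloses E.X₁psi E.Y₁psi E.X₂psiDiag := by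
  obtain ⟨E, hS, _, hE⟩ := exists_record_checks_gradedPSD
  exact fun h => not_gradedCloses_of_gradedPSD hE (h E hS)

/-- **The SYMMETRIC presentation is equally wide, closing horn:** `∃ E : SymmetricPsiGradedClosedForms, GradedCloses … ∧
¬GradedPSD …`. [cite: Zhang2022LandauSiegel, §2 (2.16)–(2.17), §8 (8.5)] -/
theorem exists_symmRecord_gradedCloses :
    ∃ E : SymmetricPsiGradedClosedForms, GradedCloses E.toPsiGradedClosedForms.X₁psi E.toPsiGradedClosedForms.Y₁psi
      E.toPsiGradedClosedForms.X₂psiDiag ∧ ¬ GradedPSD E.toPsiGradedClosedForms.X₁psi E.toPsiGradedClosedForms.Y₁psi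
      E.toPsiGradedClosedForms.X₂psiDiag := by
  obtain ⟨E, hS, hC⟩ := exists_record_symm_gradedCloses
  exact ⟨⟨E, hS.1, hS.2⟩, hC⟩

/-- … barrier horn: `∃ E : SymmetricPsiGradedClosedForms, GStarRowsDark ∧ GradedPSD …`.
[cite: Zhang2022LandauSiegel, §2 (2.16)–(2.17), §8 (8.5)] -/
theorem exists_symmRecord_gradedPSD :
    ∃ E : SymmetricPsiGradedClosedForms, E.toPsiGradedClosedForms.GStarRowsDark ∧
      GradedPSD E.toPsiGradedClosedForms.X₁psi E.toPsiGradedClosedForms.Y₁psi E.toPsiGradedClosedForms.X₂psiDiag := by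
  obtain ⟨E, hS, hD, hP⟩ := exists_record_checks_gradedPSD
  exact ⟨⟨E, hS.1, hS.2⟩, hD, hP⟩

/-- `∀ E : SymmetricPsiGradedClosedForms, GradedPSD …` is FALSE. [cite: Zhang2022LandauSiegel, §2 (2.16)–(2.17), §8 (8.5)] -/
theorem not_forall_symmRecord_gradedPSD :
    ¬ ∀ E : SymmetricPsiGradedClosedForms, GradedPSD E.toPsiGradedClosedForms.X₁psi E.toPsiGradedClosedForms.Y₁psi
      E.toPsiGradedClosedForms.X₂psiDiag := by
  obtain ⟨E, _, hE⟩ := exists_symmRecord_gradedCloses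
  exact fun h => hE (h E)

/-- `∀ E : SymmetricPsiGradedClosedForms, GradedCloses …` is FALSE. [cite: Zhang2022LandauSiegel, §2 (2.16)–(2.17), §8 (8.5)] -/
theorem not_forall_symmRecord_gradedCloses :
    ¬ ∀ E : SymmetricPsiGradedClosedForms, GradedCloses E.toPsiGradedClosedForms.X₁psi E.toPsiGradedClosedForms.Y₁psi
      E.toPsiGradedClosedForms.X₂psiDiag := by
  obtain ⟨E, _, hE⟩ := exists_symmRecord_gradedPSD
  exact fun h => not_gradedCloses_of_gradedPSD hE (h E)

end Width

end Literature.NumberTheory.LFunctions.Zhang2022.KnifeEdge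

end
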